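import Literature.AlgebraicGeometry.VanGeemen1994.WeilTypeConjugateStructureHodgeGroupSU
import Literature.AlgebraicGeometry.HodgeTheory.WeilTypeIsogenyClassSquares
import HarnessLib

/-!
# `U_H`, `SU_H` and the hypothesis `Hg = SU_H` depend only on the field `K = ℚ(φ) ⊂ End⁰(A)`, not on the generator:
# rescaling `φ ↦ Nφ` (`d ↦ N²d`) and two generators `Nφ' = ±Mφ` (van Geemen LNM 1594, 4.9 and 6.9; Moonen–Zarhin 1999 (1.9))

Family `hodge`, layer `Literature/AlgebraicGeometry/VanGeemen1994`; THEOREMS ONLY — no definition, no named fact, no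
`sorry` (D-0026, net debt 0). Lane `lit-hodgefound` (Track 2 foundations library), prover seat `lit-hodgefound-p21`,
generation 30, row g30-#13; sequel of g30-#11 (`WeilTypeConjugateStructureHodgeGroupSU`: `φ ↦ -φ`) and companion of the
tree's `HodgeTheory.isWeilType_nsmul_iff` / `isWeilType_iff_of_nsmul_eq_nsmul` («two generators of the same `K` define
the same notion of Weil type»), now for van Geemen's groups `U_H ⊃ SU_H` (6.9) and the hypothesis of Thm. 6.12.

PUBLISHED STATEMENTS (held `book:green1994-algebraic-cycles-hodge-theory-lectures-given-at` p0219, p0229). 4.9: the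
notion «abelian variety of Weil-type» is attached to the pair `(X, K)`, `K ⊂ End(X) ⊗ ℚ` an imaginary quadratic FIELD
(«for all `x ∈ K` …»); 6.9: `U_H`/`SU_H` = the matrices «which commute with the action of `K`», preserve `E`, and (for
`SU_H`) have `det = 1` on `W` and on `W̄` — the eigenspaces of `K ⊗ ℂ ≅ ℂ × ℂ`, independent of the chosen generator.
Moonen–Zarhin 1999 (1.9): the discrete invariant is the multiplicity function on the embeddings `K ↪ ℂ`.

WHAT IS PROVED (`A` a complex abelian variety, `φ φ' : A ⟶ A`, `n d d' N M : ℕ`, `h ∈ H²(A(ℂ); ℂ)` arbitrary).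
* §1 (`N ≥ 1`) `pullbackOne_nsmul_eq_smul` (`(Nφ)^* = N·φ^*`), `comm_pullbackOne_nsmul_iff`,
  `detOnEigenspace_pullbackOne_nsmul` (`det(u | ker((Nφ)^* - Nε)) = det(u | ker(φ^* - ε))`), **`weilUnitaryGroup_nsmul`**
  (`U_H(Nφ) = U_H(φ)`), **`weilSpecialUnitaryGroup_nsmul`** (`SU_H(Nφ, N²d) = SU_H(φ, d)`: `i√(N²d) = N·i√d`),
  **`hasHodgeGroupSU_nsmul_iff`**.
* §2 (two generators, `N, M ≥ 1`, `N²d' = M²d`) **`weilSpecialUnitaryGroup_eq_of_nsmul_eq_nsmul`** (`Nφ' = Mφ`),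
  **`weilSpecialUnitaryGroup_eq_of_nsmul_eq_neg_nsmul`** (`Nφ' = -Mφ`, with g30-#11), the `U_H` and `HasHodgeGroupSU`
  versions — so `SU_H` and `Hg = SU_H` (for a fixed class `h`) are invariants of `(A, K, h)`.
* §3 (`n ≥ 2`, with each generator's own `K`-symmetrised class `h_K(φ, d) = d·e^*a + φ^*e^*a`)
  **`hasHodgeGroupSU_hK_iff_of_nsmul_eq_nsmul`** / **`…_of_nsmul_eq_neg_nsmul`**: `Hg = SU_H` for `(A, φ', d', h_K(φ', d'))`
  iff for `(A, φ, d, h_K(φ, d))` (g30-#8: under `Hg = SU_H` the hypothesis holds for every non-zero class of the line `B¹ ⊗ ℂ`).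

HONESTY CLAUSE. Bookkeeping on the tree's carriers; `HasHodgeGroupSU` remains a hypothesis; `φ' ≫ φ' = -d'` is taken
as a hypothesis in §3 (as in the tree's `isWeilType_iff_of_nsmul_eq_nsmul`), not derived from `Nφ' = ±Mφ`.

## References

* [vanGeemen1994HodgeAV] B. van Geemen, *An introduction to the Hodge conjecture for abelian varieties*, LNM 1594
  (1994), 4.9, 6.9, Lemma 6.10, Thm. 6.12. [cite: vanGeemen1994HodgeAV, 4.9, 6.9 and Thm. 6.12]
* [MoonenZarhin1999LowDim] B. Moonen, Yu. Zarhin, Math. Ann. 315 (1999), (1.9). [cite: MoonenZarhin1999LowDim, (1.9)]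
* [LangeBirkenhake1992] H. Lange, Ch. Birkenhake, *Complex Abelian Varieties*, §1.1 (`ρ_a` is a ring homomorphism).
  [cite: LangeBirkenhake1992, §1.1 (p. 19)]
-/

noncomputable section

open CategoryTheory
open Literature.AlgebraicTopology.SingularHomology
open Literature.AlgebraicGeometry.Motives
open Literature.AlgebraicGeometry.HodgeTheory

namespace Literature.AlgebraicGeometry.VanGeemen1994

/-- Determinants of the restrictions of one endomorphism to two EQUAL invariant submodules agree. [folklore] -/
private theorem det_restrict_congr' {V : Type*} [AddCommGroup V] [Module ℂ V] (f : V →ₗ[ℂ] V) {p q : Submodule ℂ V}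
    (hpq : p = q) (hp : Set.MapsTo f p p) (hq : Set.MapsTo f q q) :
    LinearMap.det (f.restrict hp) = LinearMap.det (f.restrict hq) := by
  subst hpq
  rfl

/-- `√(N² d) = N √d` in `ℂ`. [folklore] -/
private theorem sqrt_sq_mul'' (N d : ℕ) : (Real.sqrt ((N ^ 2 * d : ℕ) : ℝ) : ℂ) = (N : ℂ) * (Real.sqrt d : ℂ) := by
  rw [Nat.cast_mul, Nat.cast_pow, Real.sqrt_mul' _ (Nat.cast_nonneg _), Real.sqrt_sq (Nat.cast_nonneg _),
    Complex.ofReal_mul, Complex.ofReal_natCast]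

variable {A : AbelianVariety ℂ} (φ : A ⟶ A) (n d : ℕ) (h : complexBetti A.X 2) {N M : ℕ}

/-! ### §1 Rescaling the generator: `φ ↦ Nφ`, `d ↦ N²d` -/

/-- `(Nφ)^* = N·φ^*` on `H¹(A(ℂ); ℂ)` (as a `ℂ`-multiple). [cite: LangeBirkenhake1992, §1.1 (p. 19)] -/
theorem pullbackOne_nsmul_eq_smul (N : ℕ) : pullbackOne A (N • φ) = (N : ℂ) • pullbackOne A φ := by
  rw [← natCast_zsmul φ N, pullbackOne_zsmul, Int.cast_natCast]

/-- Commuting with `(Nφ)^* = N·φ^*` (`N ≥ 1`) is commuting with `φ^*`. [cite: LangeBirkenhake1992, §1.1 (p. 19)] -/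
theorem comm_pullbackOne_nsmul_iff (hN : 0 < N) (u : complexBetti A.X 1 ≃ₗ[ℂ] complexBetti A.X 1) :
    (∀ x, u (pullbackOne A (N • φ) x) = pullbackOne A (N • φ) (u x)) ↔
      ∀ x, u (pullbackOne A φ x) = pullbackOne A φ (u x) := by
  simp only [pullbackOne_nsmul_eq_smul, LinearMap.smul_apply, map_smul]
  exact forall_congr' fun x ↦ (smul_right_injective _ (Nat.cast_ne_zero.2 hN.ne')).eq_iff

/-- **`det(u | ker((Nφ)^* - Nε)) = det(u | ker(φ^* - ε))`** (`N ≥ 1`; the eigenspaces coincide, tree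
`eigenspace_map_nsmul_one_eq`). [cite: vanGeemen1994HodgeAV, 6.9] [cite: LangeBirkenhake1992, §1.1 (p. 19)] -/
theorem detOnEigenspace_pullbackOne_nsmul (hN : 0 < N) (u : complexBetti A.X 1 ≃ₗ[ℂ] complexBetti A.X 1)
    (hc : ∀ x, u (pullbackOne A (N • φ) x) = pullbackOne A (N • φ) (u x))
    (hc' : ∀ x, u (pullbackOne A φ x) = pullbackOne A φ (u x)) (ε : ℂ) :
    detOnEigenspace u (pullbackOne A (N • φ)) hc ((N : ℂ) * ε) = detOnEigenspace u (pullbackOne A φ) hc' ε := by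
  unfold detOnEigenspace
  exact det_restrict_congr' _ (eigenspace_map_nsmul_one_eq φ hN ε) _ _

/-- **`U_H(Nφ) = U_H(φ)`** (`N ≥ 1`): `U_H` is cut out by commuting with `K = ℚ(φ) = ℚ(Nφ)` and preserving `E`.
[cite: vanGeemen1994HodgeAV, 6.9] -/
theorem weilUnitaryGroup_nsmul (hN : 0 < N) : weilUnitaryGroup A (N • φ) n h = weilUnitaryGroup A φ n h := by
  ext u
  rw [mem_weilUnitaryGroup_iff, mem_weilUnitaryGroup_iff, comm_pullbackOne_nsmul_iff φ hN]

/-- **`SU_H(Nφ, N²d) = SU_H(φ, d)`** (`N ≥ 1`): `i√(N²d) = N·i√d`, so the determinant-one conditions on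
`ker((Nφ)^* ∓ i√(N²d)) = ker(φ^* ∓ i√d)` are the same. [cite: vanGeemen1994HodgeAV, 6.9 and Lemma 6.10]
[cite: MoonenZarhin1999LowDim, (1.9)] -/
theorem weilSpecialUnitaryGroup_nsmul (hN : 0 < N) :
    weilSpecialUnitaryGroup A (N • φ) n (N ^ 2 * d) h = weilSpecialUnitaryGroup A φ n d h := by
  ext u
  rw [mem_weilSpecialUnitaryGroup_iff, mem_weilSpecialUnitaryGroup_iff, sqrt_sq_mul'']
  have e1 : Complex.I * ((N : ℂ) * (Real.sqrt d : ℂ)) = (N : ℂ) * (Complex.I * (Real.sqrt d : ℂ)) := by ring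
  have e2 : -((N : ℂ) * (Complex.I * (Real.sqrt d : ℂ))) = (N : ℂ) * (-(Complex.I * (Real.sqrt d : ℂ))) := by ring
  rw [e1, e2]
  constructor
  · rintro ⟨hc, hQ, hp, hm⟩
    have hc' := (comm_pullbackOne_nsmul_iff φ hN u).1 hc
    refine ⟨hc', hQ, ?_, ?_⟩
    · rwa [detOnEigenspace_pullbackOne_nsmul φ hN u hc hc'] at hp
    · rwa [detOnEigenspace_pullbackOne_nsmul φ hN u hc hc'] at hm
  · rintro ⟨hc', hQ, hp, hm⟩
    have hc := (comm_pullbackOne_nsmul_iff φ hN u).2 hc'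
    refine ⟨hc, hQ, ?_, ?_⟩
    · rwa [detOnEigenspace_pullbackOne_nsmul φ hN u hc hc']
    · rwa [detOnEigenspace_pullbackOne_nsmul φ hN u hc hc']

/-- **`Hg = SU_H` for `(A, Nφ, N²d, h)` iff for `(A, φ, d, h)`** (`N ≥ 1`, same class `h`).
[cite: vanGeemen1994HodgeAV, 6.9 and Thm. 6.12] [cite: MoonenZarhin1999LowDim, (1.9)] -/
theorem hasHodgeGroupSU_nsmul_iff (hN : 0 < N) :
    HasHodgeGroupSU A (N • φ) n (N ^ 2 * d) h ↔ HasHodgeGroupSU A φ n d h := by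
  rw [hasHodgeGroupSU_iff, hasHodgeGroupSU_iff, weilSpecialUnitaryGroup_nsmul φ n d h hN]

/-! ### §2 Two generators of the same `K`: `Nφ' = ±Mφ` -/

variable {φ} {φ' : A ⟶ A} {d} {d' : ℕ}

/-- **`SU_H` DEPENDS ONLY ON `K`**: if `Nφ' = Mφ` in `End(A)` with `N, M ≥ 1` and `N²d' = M²d` (so `ℚ(φ') = ℚ(φ)` and
`φ'/√-d' = ±φ/√-d`), then `SU_H(φ', d') = SU_H(φ, d)`. [cite: vanGeemen1994HodgeAV, 4.9 and 6.9] [cite: MoonenZarhin1999LowDim, (1.9)] -/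
theorem weilSpecialUnitaryGroup_eq_of_nsmul_eq_nsmul (hN : 0 < N) (hM : 0 < M) (hNM : N • φ' = M • φ)
    (hd : N ^ 2 * d' = M ^ 2 * d) :
    weilSpecialUnitaryGroup A φ' n d' h = weilSpecialUnitaryGroup A φ n d h := by
  rw [← weilSpecialUnitaryGroup_nsmul φ' n d' h hN, hNM, hd, weilSpecialUnitaryGroup_nsmul φ n d h hM]

/-- … and for `Nφ' = -Mφ` (the conjugate generator; g30-#11 `weilSpecialUnitaryGroup_neg`).
[cite: vanGeemen1994HodgeAV, 4.9 and 6.9] [cite: MoonenZarhin1999LowDim, (1.9)] -/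
theorem weilSpecialUnitaryGroup_eq_of_nsmul_eq_neg_nsmul (hN : 0 < N) (hM : 0 < M) (hNM : N • φ' = -(M • φ))
    (hd : N ^ 2 * d' = M ^ 2 * d) :
    weilSpecialUnitaryGroup A φ' n d' h = weilSpecialUnitaryGroup A φ n d h := by
  rw [← weilSpecialUnitaryGroup_nsmul φ' n d' h hN, hNM, hd, ← smul_neg, weilSpecialUnitaryGroup_nsmul (-φ) n d h hM,
    weilSpecialUnitaryGroup_neg]

/-- `U_H` depends only on `K`: `Nφ' = Mφ` ⟹ `U_H(φ') = U_H(φ)`. [cite: vanGeemen1994HodgeAV, 6.9] -/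
theorem weilUnitaryGroup_eq_of_nsmul_eq_nsmul (hN : 0 < N) (hM : 0 < M) (hNM : N • φ' = M • φ) :
    weilUnitaryGroup A φ' n h = weilUnitaryGroup A φ n h := by
  rw [← weilUnitaryGroup_nsmul φ' n h hN, hNM, weilUnitaryGroup_nsmul φ n h hM]

/-- `U_H` depends only on `K`: `Nφ' = -Mφ` ⟹ `U_H(φ') = U_H(φ)`. [cite: vanGeemen1994HodgeAV, 6.9] -/
theorem weilUnitaryGroup_eq_of_nsmul_eq_neg_nsmul (hN : 0 < N) (hM : 0 < M) (hNM : N • φ' = -(M • φ)) :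
    weilUnitaryGroup A φ' n h = weilUnitaryGroup A φ n h := by
  rw [← weilUnitaryGroup_nsmul φ' n h hN, hNM, ← smul_neg, weilUnitaryGroup_nsmul (-φ) n h hM, weilUnitaryGroup_neg]

/-- **`Hg = SU_H` (fixed class `h`) depends only on `K`**: `Nφ' = Mφ`, `N²d' = M²d` ⟹
(`HasHodgeGroupSU A φ' n d' h ↔ HasHodgeGroupSU A φ n d h`). [cite: vanGeemen1994HodgeAV, 6.9 and Thm. 6.12] -/
theorem hasHodgeGroupSU_iff_of_nsmul_eq_nsmul (hN : 0 < N) (hM : 0 < M) (hNM : N • φ' = M • φ)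
    (hd : N ^ 2 * d' = M ^ 2 * d) : HasHodgeGroupSU A φ' n d' h ↔ HasHodgeGroupSU A φ n d h := by
  rw [hasHodgeGroupSU_iff, hasHodgeGroupSU_iff, weilSpecialUnitaryGroup_eq_of_nsmul_eq_nsmul n h hN hM hNM hd]

/-- … and for `Nφ' = -Mφ`. [cite: vanGeemen1994HodgeAV, 6.9 and Thm. 6.12] -/
theorem hasHodgeGroupSU_iff_of_nsmul_eq_neg_nsmul (hN : 0 < N) (hM : 0 < M) (hNM : N • φ' = -(M • φ))
    (hd : N ^ 2 * d' = M ^ 2 * d) : HasHodgeGroupSU A φ' n d' h ↔ HasHodgeGroupSU A φ n d h := by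
  rw [hasHodgeGroupSU_iff, hasHodgeGroupSU_iff, weilSpecialUnitaryGroup_eq_of_nsmul_eq_neg_nsmul n h hN hM hNM hd]

/-! ### §3 With each generator's own `K`-symmetrised class (`n ≥ 2`) -/

section Package

variable (A) (φ φ' : A ⟶ A) (n d d' : ℕ) (e : ProjectiveEmbedding A.X) (a : complexBetti (projectiveSpace e.n ℂ) 2)

/-- **`Hg = SU_H` FOR `(A, φ', d')` WITH ITS CLASS `h_K(φ', d') = d'·e^*a + φ'^*e^*a` IFF FOR `(A, φ, d)` WITH
`h_K(φ, d)`**, whenever `Nφ' = Mφ`, `N²d' = M²d` (`N, M ≥ 1`; `dim A = 2n`, `n ≥ 2`, `φ ≫ φ = -d`, `φ' ≫ φ' = -d'`,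
`a` rational non-zero): both classes are non-zero members of `B¹ ⊗ ℂ`, a line under either hypothesis (g30-#8), and
`SU_H(φ', d') = SU_H(φ, d)` (§2). [cite: vanGeemen1994HodgeAV, 4.9, 6.9 and Thm. 6.12] [cite: MoonenZarhin1999LowDim, (1.9)] -/
theorem hasHodgeGroupSU_hK_iff_of_nsmul_eq_nsmul (hN : 0 < N) (hM : 0 < M) (hNM : N • φ' = M • φ)
    (hdd : N ^ 2 * d' = M ^ 2 * d) (hn : 2 ≤ n) (hd : 0 < d) (hA : A.dim = 2 * n) (hφ : φ ≫ φ = -(d • 𝟙 A))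
    (hφ' : φ' ≫ φ' = -(d' • 𝟙 A)) (ha : IsRationalClass a) (ha0 : a ≠ 0) :
    HasHodgeGroupSU A φ' n d' (hK d' φ' e a) ↔ HasHodgeGroupSU A φ n d (hK d φ e a) := by
  have hd' : 0 < d' := by
    have hpos : 0 < N ^ 2 * d' := by rw [hdd]; exact Nat.mul_pos (pow_pos hM 2) hd
    exact Nat.pos_of_mul_pos_left hpos
  constructor
  · intro hSU
    rw [← hasHodgeGroupSU_iff_of_nsmul_eq_nsmul n (hK d φ e a) hN hM hNM hdd]
    exact hasHodgeGroupSU_of_mem_hodgeClassSpan_one A φ' n d' e a hn hd' hA hφ' ha ha0 hSU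
      (hK_mem_hodgeClassSpan hn hd hA e ha ha0) (hK_ne_zero A φ n d e a (by omega) hd hA ha ha0)
  · intro hSU
    rw [hasHodgeGroupSU_iff_of_nsmul_eq_nsmul n (hK d' φ' e a) hN hM hNM hdd]
    exact hasHodgeGroupSU_of_mem_hodgeClassSpan_one A φ n d e a hn hd hA hφ ha ha0 hSU
      (hK_mem_hodgeClassSpan hn hd' hA e ha ha0) (hK_ne_zero A φ' n d' e a (by omega) hd' hA ha ha0)

/-- … and for `Nφ' = -Mφ`. [cite: vanGeemen1994HodgeAV, 4.9, 6.9 and Thm. 6.12] [cite: MoonenZarhin1999LowDim, (1.9)] -/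
theorem hasHodgeGroupSU_hK_iff_of_nsmul_eq_neg_nsmul (hN : 0 < N) (hM : 0 < M) (hNM : N • φ' = -(M • φ))
    (hdd : N ^ 2 * d' = M ^ 2 * d) (hn : 2 ≤ n) (hd : 0 < d) (hA : A.dim = 2 * n) (hφ : φ ≫ φ = -(d • 𝟙 A))
    (hφ' : φ' ≫ φ' = -(d' • 𝟙 A)) (ha : IsRationalClass a) (ha0 : a ≠ 0) :
    HasHodgeGroupSU A φ' n d' (hK d' φ' e a) ↔ HasHodgeGroupSU A φ n d (hK d φ e a) := by
  have hd' : 0 < d' := by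
    have hpos : 0 < N ^ 2 * d' := by rw [hdd]; exact Nat.mul_pos (pow_pos hM 2) hd
    exact Nat.pos_of_mul_pos_left hpos
  constructor
  · intro hSU
    rw [← hasHodgeGroupSU_iff_of_nsmul_eq_neg_nsmul n (hK d φ e a) hN hM hNM hdd]
    exact hasHodgeGroupSU_of_mem_hodgeClassSpan_one A φ' n d' e a hn hd' hA hφ' ha ha0 hSU
      (hK_mem_hodgeClassSpan hn hd hA e ha ha0) (hK_ne_zero A φ n d e a (by omega) hd hA ha ha0)
  · intro hSU
    rw [hasHodgeGroupSU_iff_of_nsmul_eq_neg_nsmul n (hK d' φ' e a) hN hM hNM hdd]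
    exact hasHodgeGroupSU_of_mem_hodgeClassSpan_one A φ n d e a hn hd hA hφ ha ha0 hSU
      (hK_mem_hodgeClassSpan hn hd' hA e ha ha0) (hK_ne_zero A φ' n d' e a (by omega) hd' hA ha ha0)

end Package

end Literature.AlgebraicGeometry.VanGeemen1994
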